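import Mathlib
import HarnessLib

/-!
# [telescope — width x2-p2 g24, 2026-08-30] (D3), hull half: finitely generated TORSION-FREE modules over a domain are
TORSIONLESS (`N ↪ N**`) — so over `𝒪⟦X⟧` the reflexive hull `N ↪ N**` is an embedding into a FREE module

Companion to `…Theorems.EisensteinPrimesBSDpOnCellCTelescopeBranchReflexiveHullFree` (duals / double duals of finitely
generated `𝒪⟦X⟧`-modules are free). Step (D3) of the transcription of crux 4's load-bearing cited fact
(`Literature.NumberTheory.EllipticCurves.PNewBranchGaloisLattice`, rider «TU-hull» / «TF-hull») replaces the torsion-free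
base change `N = (L ⊗ ℤ_p⟦X⟧)/torsion` of Hida's lattice by its reflexive hull `N**`; that this IS a hull — the canonical map
`Module.Dual.eval : N → N**` is injective — is the content of this file, for every finitely generated torsion-free module
over any commutative domain (Mathlib's `Module.eval_apply_injective` needs `Module.Projective`):

* `exists_smul_mem_free`: a single non-zero scalar `d` carries `N` into a finite free submodule `F` (a maximal linearly
  independent subfamily of a generating family spans `F`; [folklore]);
* `dual_eval_injective`: hence linear forms separate points and `N → N**` is injective [cite: BrunsHerzog1998, §1.4 (torsionless modules), Prop. 1.4.1];
* `dual_eval_injective_powerSeries`: the `𝒪⟦X⟧` instance (`𝒪` a domain, e.g. `ℤ_p`).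

Helper toward crux 4 [stmt …-19034] (`--supports`); it changes no registered stub, proves nothing about Hida's lattice
itself, and proves no summit statement; BSD is proved for no curve.
-/

set_option autoImplicit false
set_option linter.dupNamespace false

namespace Summit.BirchSwinnertonDyer.BirchSwinnertonDyer.Theorems.TelescopeBranchTorsionlessOfTorsionFree

/-- A finitely generated torsion-free module over a domain is carried into a finite free submodule by a single non-zero
scalar: `d • N ⊆ F`, `F` free. [folklore] -/
theorem exists_smul_mem_free {R N : Type*} [CommRing R] [IsDomain R] [AddCommGroup N] [Module R N] [Module.Finite R N] :
    ∃ (d : R) (F : Submodule R N), d ≠ 0 ∧ Module.Free R F ∧ ∀ v : N, d • v ∈ F := by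
  classical
  obtain ⟨m, g, hg⟩ := Module.Finite.exists_fin (R := R) (M := N)
  obtain ⟨s, hs, hmax⟩ := exists_maximal_linearIndepOn R g
  choose! a ha0 ha using hmax
  let F : Submodule R N := Submodule.span R (Set.range fun i : s => g i)
  have hFs : ∀ i ∈ s, g i ∈ F := fun i hi => Submodule.subset_span ⟨⟨i, hi⟩, rfl⟩
  have hFa : ∀ i ∉ s, a i • g i ∈ F := by
    intro i hi
    have h := ha i hi
    have hrange : (Set.range fun i : s => g i) = g '' s := (Set.image_eq_range g s).symm
    change a i • g i ∈ Submodule.span R (Set.range fun i : s => g i)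
    rwa [hrange]
  let d : R := ∏ i ∈ Finset.univ.filter (fun i => i ∉ s), a i
  refine ⟨d, F, ?_, Module.Free.of_basis (Module.Basis.span hs), ?_⟩
  · exact Finset.prod_ne_zero_iff.mpr fun i hi => ha0 i (Finset.mem_filter.mp hi).2
  · -- it suffices to treat the generators
    suffices h : ∀ i, d • g i ∈ F by
      intro v
      have hv : v ∈ Submodule.span R (Set.range g) := by rw [hg]; exact Submodule.mem_top
      refine Submodule.span_induction (p := fun w _ => d • w ∈ F) ?_ ?_ ?_ ?_ hv
      · rintro _ ⟨i, rfl⟩; exact h i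
      · rw [smul_zero]; exact F.zero_mem
      · intro w w' _ _ hw hw'; rw [smul_add]; exact F.add_mem hw hw'
      · intro r w _ hw; rw [smul_comm]; exact F.smul_mem r hw
    intro i
    by_cases hi : i ∈ s
    · exact F.smul_mem d (hFs i hi)
    · have hdvd : a i ∣ d := Finset.dvd_prod_of_mem a (Finset.mem_filter.mpr ⟨Finset.mem_univ i, hi⟩)
      obtain ⟨d', hd'⟩ := hdvd
      rw [hd', mul_comm, mul_smul]
      exact F.smul_mem d' (hFa i hi)

/-- **Torsion-free finitely generated modules over a domain are torsionless**: the canonical map to the double dual is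
injective. [folklore; cf. BrunsHerzog1998, 1.4.1] -/
theorem dual_eval_injective {R N : Type*} [CommRing R] [IsDomain R] [AddCommGroup N] [Module R N] [Module.Finite R N]
    [NoZeroSMulDivisors R N] : Function.Injective (Module.Dual.eval R N) := by
  obtain ⟨d, F, hd, hF, hdF⟩ := exists_smul_mem_free (R := R) (N := N)
  rw [injective_iff_map_eq_zero]
  intro v hv
  by_contra hv0
  have hdv : (⟨d • v, hdF v⟩ : F) ≠ 0 := by
    intro h
    rw [Subtype.ext_iff, Submodule.coe_zero, smul_eq_zero] at h
    exact h.elim hd hv0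
  obtain ⟨φ, hφ⟩ := Module.Projective.exists_dual_ne_zero R hdv
  let j : N →ₗ[R] F := LinearMap.codRestrict F (d • LinearMap.id) (fun w => by simpa using hdF w)
  have hj : ∀ w, j w = ⟨d • w, hdF w⟩ := fun w => rfl
  have h1 : (Module.Dual.eval R N v) (φ ∘ₗ j) = 0 := by rw [hv, LinearMap.zero_apply]
  rw [Module.Dual.eval_apply, LinearMap.comp_apply, hj] at h1
  exact hφ h1


/-- **(D3), hull half, for `𝒪⟦X⟧`.** A finitely generated torsion-free `𝒪⟦X⟧`-module (`𝒪` a domain, e.g. `ℤ_p`) embeds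
into its double dual (its reflexive hull) by the canonical map. [cite: BrunsHerzog1998, Prop. 1.4.1] -/
theorem dual_eval_injective_powerSeries (𝒪 : Type*) [CommRing 𝒪] [IsDomain 𝒪]
    (N : Type*) [AddCommGroup N] [Module (PowerSeries 𝒪) N] [Module.Finite (PowerSeries 𝒪) N]
    [NoZeroSMulDivisors (PowerSeries 𝒪) N] : Function.Injective (Module.Dual.eval (PowerSeries 𝒪) N) :=
  dual_eval_injective

end Summit.BirchSwinnertonDyer.BirchSwinnertonDyer.Theorems.TelescopeBranchTorsionlessOfTorsionFree
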